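import Summits.Ventures.HSemireg.EquidistributionDesignsN4

/-!
# Venture HSemireg — **SPECTRUM(4) = {16 t : t ≥ 4}**: the set of total masses of non-negative slanted designs at n = 4 (g = 8), the
# second half of the census's DOOR (d5) words «M_min(4) = 64 EXACT and SPECTRUM(4) = {16t : t ≥ 4}», FILED VERBATIM from t-22 g5's
# kernel file (the part `EquidistributionDesignsN4.lean` names as «NOT cut: … SPECTRUM(4)»)

HONEST FRAMING. Part of the Lean index of the computation cell `pub-hsemireg` (filed by the Sunday typer seat p9 g3, § g = 8; AUTHOR
of the mathematics and of the Lean text: seat t-22 g5, folder-local file `target-g8/t22/out/gf2/EQD.lean` sha256∕16 `91feb766668004a7`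
(= `target-g8/t21/reruns/EQD_t22_91feb766668004a7.lean`), §§ «SPECTRUM(4)» and «General n» l.626–771, re-checked rc 0 with standard
axioms by t-21 g7∕g8 — census row P22-6 c9: «`T22g5EQD.spectrum_n4` … kernel-grade; INDEPENDENT RE-CHECK AT THIS SEAT … #print axioms
T22g5EQD.spectrum_n4 = [propext, Classical.choice, Quot.sound]»; census §0 DOOR (d5) WORDS: «M_min(4) = 64 EXACT and SPECTRUM(4) =
{16t : t ≥ 4} — THEOREM EQD hand ×3 (t-22 ∣ th-5 ∣ t-25) + integer-verified designs + LEAN KERNEL ×2 ACROSS SEATS»; CENSUS-g8 v1.274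
`7744dc4867915f69`). FINITE CHARACTER SUMS over `(ZMod 3)^(n+1) × Bool^(n+1)` ONLY: no variety, no sheaf, no semiregularity map;
nothing here says that HC ∕ HC_CM ∕ HC_AV holds; no Literature fact is declared or used. The BRIDGE from slanted designs to h-free
pure-Weil W-alive positive designs on `E_K⁸` is s0-3's MODEL THEOREM (door P) and is NOT part of this file — as in the parent file.

WHAT IS CUT (verbatim, namespace `T22g5EQD` ↦ `Summit.Ventures.HSemireg.EQD`, two one-line docstrings added — `m64cube_valid`,
`addCubes_valid`; nothing else changed): dual orthogonality `sum_chi_eq_zero` (`Σ_a χ_S(a) = 0` for `S ≠ ∅`); `m64cube` ∕ `m64cube_valid`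
(the tree's 64-atom design `m64` plus `u` full sign cubes at one site is a design of mass `64 + 16u`); **`spectrum_n4`**: a total mass
`M` is attained by a non-negative integral design at n = 4 (slanted alphabet `fslant = (1,−1,0)`, (M_S) for all proper non-empty `S`,
(T)) **iff `M = 16t` with `t ≥ 4`** (⇐ the cube construction; ⇒ the tree's `two_pow_dvd_mass` + `mass_ge_64_at_n4`); and the general-n
shape `addCubes` ∕ `addCubes_valid` ∕ `spectrum_shape` (one design of mass `M₀` ⇒ every `M₀ + 2^(n+1)·t`; every mass is a multiple of
`2^(n+1)`). NOT cut (stay in the source file): the n = 5 statements (`spectrum_n5_necessary`, M_min(5) = 192 — level g = 10),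
COROLLARY EQD-H, the n = 2 ∕ 3 bench. Uses from the parent tree file: `σ`, `chi`, `fslant`, `m64`, `design64_valid`,
`two_pow_dvd_mass`, `mass_ge_64_at_n4`.
-/

open Finset

namespace Summit.Ventures.HSemireg.EQD

/-! ## SPECTRUM(4) = {16 t : t ≥ 4}: dual orthogonality `Σ_a χ_S(a) = 0` (S ≠ ∅) ⇒ adding `u` full sign cubes at one site keeps (M_S), (T). -/

/-- dual orthogonality: for non-empty `S`, `Σ_a χ_S(a) = 0` (flip one coordinate `k ∈ S`). -/
theorem sum_chi_eq_zero {n : ℕ} (S : Finset (Fin n)) (hS : S.Nonempty) : ∑ a : Fin n → Bool, chi S a = 0 := by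
  obtain ⟨k, hk⟩ := hS
  set φ : (Fin n → Bool) → (Fin n → Bool) := fun a => Function.update a k (!a k) with hφ
  have hinv : Function.Involutive φ := by
    intro a; ext i
    by_cases h : i = k
    · subst h; simp [hφ]
    · simp [hφ, Function.update_of_ne h]
  have hneg : ∀ a, chi S (φ a) = - chi S a := by
    intro a
    unfold chi
    rw [← Finset.mul_prod_erase S (fun i => σ (φ a i)) hk, ← Finset.mul_prod_erase S (fun i => σ (a i)) hk]
    have h1 : σ (φ a k) = - σ (a k) := by
      simp only [hφ, Function.update_self]
      cases a k <;> simp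
    have h2 : ∏ i ∈ S.erase k, σ (φ a i) = ∏ i ∈ S.erase k, σ (a i) := by
      refine Finset.prod_congr rfl (fun i hi => ?_)
      have : i ≠ k := Finset.ne_of_mem_erase hi
      simp [hφ, Function.update_of_ne this]
    rw [h1, h2]; ring
  have hsum : ∑ a : Fin n → Bool, chi S a = ∑ a : Fin n → Bool, chi S (φ a) :=
    (Fintype.sum_equiv (hinv.toPerm φ) (fun a => chi S (φ a)) (fun a => chi S a) (fun a => rfl)).symm
  simp_rw [hneg, Finset.sum_neg_distrib] at hsum
  linarith

/-- the M = 64 design plus `u` full sign cubes at the site `0`. -/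
def m64cube (u : ℤ) (z : Fin 4 → ZMod 3) (a : Fin 4 → Bool) : ℤ := m64 z a + if z = 0 then u else 0

/-- `m64cube u` is a non-negative design of mass `64 + 16u` satisfying (M_S) for every proper non-empty `S` and (T) with the slanted
alphabet — from `design64_valid` and dual orthogonality. -/
theorem m64cube_valid (u : ℤ) (hu : 0 ≤ u) :
    (∀ z a, 0 ≤ m64cube u z a) ∧ (∑ z, ∑ a, m64cube u z a = 64 + 16 * u) ∧
    (∀ S : Finset (Fin 4), S.Nonempty → S ≠ univ →
      ∀ zS : S → ZMod 3, ∑ z ∈ (univ.filter fun z : Fin 4 → ZMod 3 => (fun k : S => z k) = zS),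
        ∑ a, m64cube u z a * chi S a = 0) ∧
    (∀ z : Fin 4 → ZMod 3, ∑ a, m64cube u z a * chi univ a = fslant (∑ k, z k)) := by
  obtain ⟨h0, hM, hMS, hT⟩ := design64_valid
  refine ⟨?_, ?_, ?_, ?_⟩
  · intro z a; unfold m64cube; have := h0 z a; split <;> linarith
  · have hcube : ∑ z : Fin 4 → ZMod 3, ∑ _a : Fin 4 → Bool, (if z = 0 then u else 0) = 16 * u := by
      rw [Finset.sum_comm]
      simp only [Finset.sum_ite_eq', Finset.mem_univ, if_true, Finset.sum_const, Finset.card_univ, nsmul_eq_mul]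
      rw [Fintype.card_fun, Fintype.card_bool, Fintype.card_fin]; norm_num
    unfold m64cube
    simp only [Finset.sum_add_distrib]
    rw [hM, hcube]
  · intro S hS hSU zS
    unfold m64cube
    simp only [add_mul, Finset.sum_add_distrib]
    rw [hMS S hS hSU zS, zero_add]
    refine Finset.sum_eq_zero (fun z _ => ?_)
    rw [← Finset.mul_sum]
    rw [sum_chi_eq_zero S hS, mul_zero]
  · intro z
    unfold m64cube
    simp only [add_mul, Finset.sum_add_distrib]
    rw [hT z, ← Finset.mul_sum, sum_chi_eq_zero univ Finset.univ_nonempty, mul_zero, add_zero]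

/-- **SPECTRUM(4) = {16 t : t ≥ 4}** (f = (1,−1,0)): the set of total masses of non-negative integral designs at n = 4. -/
theorem spectrum_n4 (M : ℤ) :
    (∃ m : (Fin 4 → ZMod 3) → (Fin 4 → Bool) → ℤ, (∀ z a, 0 ≤ m z a) ∧
      (∀ S : Finset (Fin 4), S.Nonempty → S ≠ univ →
        ∀ zS : S → ZMod 3, ∑ z ∈ (univ.filter fun z : Fin 4 → ZMod 3 => (fun k : S => z k) = zS),
          ∑ a, m z a * chi S a = 0) ∧
      (∀ z : Fin 4 → ZMod 3, ∑ a, m z a * chi univ a = fslant (∑ k, z k)) ∧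
      ∑ z, ∑ a, m z a = M)
    ↔ ∃ t : ℤ, 4 ≤ t ∧ M = 16 * t := by
  constructor
  · rintro ⟨m, hm, hMS, hT, hsum⟩
    have h1 : (2 : ℤ) ^ (3 + 1) ∣ ∑ z, ∑ a, m z a := two_pow_dvd_mass 3 m fslant (by decide) hMS hT
    have h2 : 64 ≤ ∑ z, ∑ a, m z a := mass_ge_64_at_n4 m fslant (by decide) (by decide) hm hMS hT
    obtain ⟨t, ht⟩ := h1
    have e16 : (2 : ℤ) ^ (3 + 1) = 16 := by norm_num
    rw [e16] at ht
    exact ⟨t, by omega, by omega⟩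
  · rintro ⟨t, ht, rfl⟩
    obtain ⟨h0, hM, hMS, hT⟩ := m64cube_valid (t - 4) (by omega)
    exact ⟨m64cube (t - 4), h0, hMS, hT, by rw [hM]; ring⟩


/-! ## General n: adding `u ≥ 0` full sign cubes at one site maps designs to designs (mass `+ 2^(n+1)·u`), so the mass spectrum
is an upward-closed union of residue-class rays `M₀ + 2^(n+1)·ℕ`; with EQD (`2^(n+1) ∣ M`) it is `{2^(n+1)·t : t ≥ t_min}` as soon as one design exists. -/

/-- a design plus `u` full sign cubes at the site `z₀`. -/
def addCubes {n : ℕ} (m : (Fin (n + 1) → ZMod 3) → (Fin (n + 1) → Bool) → ℤ) (z₀ : Fin (n + 1) → ZMod 3) (u : ℤ)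
    (z : Fin (n + 1) → ZMod 3) (a : Fin (n + 1) → Bool) : ℤ :=
  m z a + if z = z₀ then u else 0

/-- adding `u ≥ 0` full sign cubes at one site maps non-negative designs (alphabet `f`) to non-negative designs, mass `+ 2^(n+1)·u`. -/
theorem addCubes_valid (n : ℕ) (m : (Fin (n + 1) → ZMod 3) → (Fin (n + 1) → Bool) → ℤ) (f : ZMod 3 → ℤ)
    (hm : ∀ z a, 0 ≤ m z a)
    (hM : ∀ S : Finset (Fin (n + 1)), S.Nonempty → S ≠ univ →
      ∀ zS : S → ZMod 3, ∑ z ∈ (univ.filter fun z : Fin (n + 1) → ZMod 3 => (fun k : S => z k) = zS),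
        ∑ a, m z a * chi S a = 0)
    (hT : ∀ z : Fin (n + 1) → ZMod 3, ∑ a, m z a * chi univ a = f (∑ k, z k))
    (z₀ : Fin (n + 1) → ZMod 3) (u : ℤ) (hu : 0 ≤ u) :
    (∀ z a, 0 ≤ addCubes m z₀ u z a) ∧
    (∑ z, ∑ a, addCubes m z₀ u z a = (∑ z, ∑ a, m z a) + 2 ^ (n + 1) * u) ∧
    (∀ S : Finset (Fin (n + 1)), S.Nonempty → S ≠ univ →
      ∀ zS : S → ZMod 3, ∑ z ∈ (univ.filter fun z : Fin (n + 1) → ZMod 3 => (fun k : S => z k) = zS),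
        ∑ a, addCubes m z₀ u z a * chi S a = 0) ∧
    (∀ z : Fin (n + 1) → ZMod 3, ∑ a, addCubes m z₀ u z a * chi univ a = f (∑ k, z k)) := by
  refine ⟨?_, ?_, ?_, ?_⟩
  · intro z a; unfold addCubes; have := hm z a; split <;> linarith
  · have hcube : ∑ z : Fin (n + 1) → ZMod 3, ∑ _a : Fin (n + 1) → Bool, (if z = z₀ then u else 0) = 2 ^ (n + 1) * u := by
      rw [Finset.sum_comm]
      simp only [Finset.sum_ite_eq', Finset.mem_univ, if_true, Finset.sum_const, Finset.card_univ, nsmul_eq_mul]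
      rw [Fintype.card_fun, Fintype.card_bool, Fintype.card_fin]; push_cast; ring
    unfold addCubes
    simp only [Finset.sum_add_distrib]
    rw [hcube]
  · intro S hS hSU zS
    unfold addCubes
    simp only [add_mul, Finset.sum_add_distrib]
    rw [hM S hS hSU zS, zero_add]
    refine Finset.sum_eq_zero (fun z _ => ?_)
    rw [← Finset.mul_sum, sum_chi_eq_zero S hS, mul_zero]
  · intro z
    unfold addCubes
    simp only [add_mul, Finset.sum_add_distrib]
    rw [hT z, ← Finset.mul_sum, sum_chi_eq_zero univ Finset.univ_nonempty, mul_zero, add_zero]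

/-- **SPECTRUM, general shape.** If one non-negative design of mass `M₀` exists (alphabet `f`), then every `M₀ + 2^(n+1)·t`, `t ≥ 0`,
is the mass of a non-negative design; and (EQD) every design mass is a multiple of `2^(n+1)`. -/
theorem spectrum_shape (n : ℕ) (f : ZMod 3 → ℤ) (hf : f 0 + f 1 + f 2 = 0)
    (m₀ : (Fin (n + 1) → ZMod 3) → (Fin (n + 1) → Bool) → ℤ) (hm₀ : ∀ z a, 0 ≤ m₀ z a)
    (hM₀ : ∀ S : Finset (Fin (n + 1)), S.Nonempty → S ≠ univ →
      ∀ zS : S → ZMod 3, ∑ z ∈ (univ.filter fun z : Fin (n + 1) → ZMod 3 => (fun k : S => z k) = zS),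
        ∑ a, m₀ z a * chi S a = 0)
    (hT₀ : ∀ z : Fin (n + 1) → ZMod 3, ∑ a, m₀ z a * chi univ a = f (∑ k, z k)) :
    (∀ t : ℤ, 0 ≤ t → ∃ m : (Fin (n + 1) → ZMod 3) → (Fin (n + 1) → Bool) → ℤ, (∀ z a, 0 ≤ m z a) ∧
      (∀ S : Finset (Fin (n + 1)), S.Nonempty → S ≠ univ →
        ∀ zS : S → ZMod 3, ∑ z ∈ (univ.filter fun z : Fin (n + 1) → ZMod 3 => (fun k : S => z k) = zS),
          ∑ a, m z a * chi S a = 0) ∧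
      (∀ z : Fin (n + 1) → ZMod 3, ∑ a, m z a * chi univ a = f (∑ k, z k)) ∧
      ∑ z, ∑ a, m z a = (∑ z, ∑ a, m₀ z a) + 2 ^ (n + 1) * t) ∧
    (∀ m : (Fin (n + 1) → ZMod 3) → (Fin (n + 1) → Bool) → ℤ,
      (∀ S : Finset (Fin (n + 1)), S.Nonempty → S ≠ univ →
        ∀ zS : S → ZMod 3, ∑ z ∈ (univ.filter fun z : Fin (n + 1) → ZMod 3 => (fun k : S => z k) = zS),
          ∑ a, m z a * chi S a = 0) →
      (∀ z : Fin (n + 1) → ZMod 3, ∑ a, m z a * chi univ a = f (∑ k, z k)) →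
      (2 : ℤ) ^ (n + 1) ∣ ∑ z, ∑ a, m z a) := by
  refine ⟨fun t ht => ?_, fun m hM hT => two_pow_dvd_mass n m f hf hM hT⟩
  obtain ⟨h0, hsum, hMS, hT⟩ := addCubes_valid n m₀ f hm₀ hM₀ hT₀ 0 t ht
  exact ⟨addCubes m₀ 0 t, h0, hMS, hT, hsum⟩

end Summit.Ventures.HSemireg.EQD
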